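import Mathlib
import HarnessLib
import Literature.MathematicalPhysics.QuantumLattice.HubbardModelThermodynamicLimitProofs
import Literature.MathematicalPhysics.QuantumLattice.FermionRelabelling
import Summits.HubbardSuperconductivity.HubbardSuperconductivity.Theorems.WeakCouplingBCSWcbcsBcsConstructionBoxTilingRectangles

/-!
# Route `WeakCouplingBCS` — crux `WcbcsBcsConstruction` (stmt-HubbardSuperconductivity-2010),
# line `lro-seed-kink-bridge`, stub `stub_boxTiling`

Energetics of the grand-canonical ground energy `a(L) = E₀(H(1,U) - μN)` of the free-boundary
`L × L` Hubbard box (vertex type `FermionTorus 2 L = Lex (Fin 2 → Fin L)`, nearest-neighbour graph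
pulled back from `ℤ²`), from the hypothesis (registered stub `stub_gcGroundEnergyEqMin`) that the
grand-canonical ground energy is the minimum over particle numbers of the sector energies:

* `box_groundEnergy_eq_rect`: the box is (graph-isomorphic to) the `L × L` rectangle of
  `WeakCouplingBCSWcbcsBcsConstructionBoxTilingRectangles.lean`, so `a(L) = E₀(L, L)`;
* `rect_groundEnergy_sq_mul_le`: `E₀(kM, kM) ≤ k² E₀(M, M)` (stack `k` strips, transpose, stack);
* `rect_groundEnergy_sq_add_le`: `E₀(M+D, M+D) ≤ E₀(M, M)` (cut off strips of energy `≤ 0`);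
* `stub_boxTiling`: the registered stub, with `C = 0` and `c = 5(2 + |U| + 2|μ|)`.

Ruelle, *Statistical Mechanics* (1969) §2.1–2.2 (thermodynamic limit by sub-additivity). No
definitions; everything is proved.
-/

set_option linter.dupNamespace false

namespace Summit.HubbardSuperconductivity.HubbardSuperconductivity.Theorems

open Literature.MathematicalPhysics.QuantumLattice Literature.Probability.LatticeModels Matrix Filter
open scoped Matrix.Norms.L2Operator ComplexOrder Topology

namespace WcbcsBoxTiling

/-- **The square box is the `L × L` rectangle**: `x ↦ (x₀, x₁)` is a graph isomorphism of the
free-boundary box on `FermionTorus 2 L = Lex (Fin 2 → Fin L)` onto the `L × L` rectangle, so the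
grand-canonical ground energies agree. [folklore] -/
theorem box_groundEnergy_eq_rect (L : ℕ) (t U μ : ℝ) :
    (hamiltonianWith ((zdGraph 2).comap (fun x : FermionTorus 2 L => fun i : Fin 2 => ((ofLex x i : ℕ) : ℤ))) t U μ).groundEnergy =
      (hamiltonianWith ((zdGraph 2).comap
        (fun p : Lex (Fin L × Fin L) => ![((ofLex p).1 : ℤ), ((ofLex p).2 : ℤ)])) t U μ).groundEnergy := by
  have key : ∀ z : Lex (Fin L × Fin L),
      (fun i : Fin 2 =>
        ((ofLex ((ofLex.trans (((finTwoArrowEquiv (Fin L)).symm).trans toLex)) z) i : ℕ) : ℤ)) =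
        ![((ofLex z).1 : ℤ), ((ofLex z).2 : ℤ)] := by
    intro z
    funext i
    fin_cases i <;> rfl
  have h := gc_groundEnergy_eq_of_iso
    ((zdGraph 2).comap (fun p : Lex (Fin L × Fin L) => ![((ofLex p).1 : ℤ), ((ofLex p).2 : ℤ)]))
    ((zdGraph 2).comap (fun x : FermionTorus 2 L => fun i : Fin 2 => ((ofLex x i : ℕ) : ℤ)))
    (ofLex.trans (((finTwoArrowEquiv (Fin L)).symm).trans toLex))
    (fun x y => by rw [SimpleGraph.comap_adj, SimpleGraph.comap_adj, key, key]) t U μ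
  -- the synthesised `DecidableEq (FermionTorus 2 L)` of the statement is not the (classical) one
  -- carried by the lexicographic `LinearOrder` used inside the general lemma: `convert` closes the
  -- mismatch by `Subsingleton.elim`
  convert h using 3

variable (hmin : ∀ {Λ : Type} [LinearOrder Λ] [Fintype Λ] (G : SimpleGraph Λ) [DecidableRel G.Adj]
    (t U μ : ℝ), (hamiltonianWith G t U μ).groundEnergy =
      ⨅ N : Fin (2 * Fintype.card Λ + 1), (groundEnergyAt G t U (N : ℕ) - μ * ((N : ℕ) : ℝ)))
include hmin

/-- **Tiling sub-additivity of squares**: `E₀(kM, kM) ≤ k² E₀(M, M)` (stack `k` strips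
`M × kM`, transpose each to `kM × M`, stack again: `stub_wcbcsBoxTilingRectangles` twice and
`rect_groundEnergy_transpose`). [folklore] -/
theorem rect_groundEnergy_sq_mul_le (k M : ℕ) (t U μ : ℝ) :
    (hamiltonianWith ((zdGraph 2).comap
        (fun p : Lex (Fin (k * M) × Fin (k * M)) => ![((ofLex p).1 : ℤ), ((ofLex p).2 : ℤ)])) t U μ).groundEnergy ≤
      (k : ℝ) ^ 2 * (hamiltonianWith ((zdGraph 2).comap
        (fun p : Lex (Fin M × Fin M) => ![((ofLex p).1 : ℤ), ((ofLex p).2 : ℤ)])) t U μ).groundEnergy := by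
  have h1 := stub_wcbcsBoxTilingRectangles hmin M (k * M) k t U μ
  have h2 := rect_groundEnergy_transpose (k * M) M t U μ
  have h3 := mul_le_mul_of_nonneg_left (stub_wcbcsBoxTilingRectangles hmin M M k t U μ)
    (Nat.cast_nonneg (α := ℝ) k)
  rw [h2] at h1
  calc _ ≤ _ := h1
    _ ≤ _ := h3
    _ = _ := by ring

/-- **Monotonicity of squares**: `E₀(M+D, M+D) ≤ E₀(M, M)` (cut off the last `D` rows, whose
energy is `≤ 0`, transpose, cut again). [folklore] -/
theorem rect_groundEnergy_sq_add_le (M D : ℕ) (t U μ : ℝ) :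
    (hamiltonianWith ((zdGraph 2).comap
        (fun p : Lex (Fin (M + D) × Fin (M + D)) => ![((ofLex p).1 : ℤ), ((ofLex p).2 : ℤ)])) t U μ).groundEnergy ≤
      (hamiltonianWith ((zdGraph 2).comap
        (fun p : Lex (Fin M × Fin M) => ![((ofLex p).1 : ℤ), ((ofLex p).2 : ℤ)])) t U μ).groundEnergy := by
  have h1 := rect_groundEnergy_rowCut_le hmin (rfl : M + D = M + D) (M + D) t U μ
  have h2 := gc_groundEnergy_nonpos ((zdGraph 2).comap
    (fun p : Lex (Fin D × Fin (M + D)) => ![((ofLex p).1 : ℤ), ((ofLex p).2 : ℤ)])) t U μ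
  have h3 := rect_groundEnergy_transpose (M + D) M t U μ
  have h4 := rect_groundEnergy_rowCut_le hmin (rfl : M + D = M + D) M t U μ
  have h5 := gc_groundEnergy_nonpos ((zdGraph 2).comap
    (fun p : Lex (Fin D × Fin M) => ![((ofLex p).1 : ℤ), ((ofLex p).2 : ℤ)])) t U μ
  linarith

end WcbcsBoxTiling

open WcbcsBoxTiling in
/-- **Stub `stub_boxTiling`** of the line `lro-seed-kink-bridge` (crux `WcbcsBcsConstruction`):
**energetics of free-boundary Hubbard boxes.** Assume the grand-canonical ground energy of every
finite Hubbard graph is the minimum over particle numbers of the sector energies (the registered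
stub `stub_gcGroundEnergyEqMin`). Then the grand-canonical ground energy `a(L)` of `H(1,U) - μN`
on the `L × L` box with free boundary conditions (vertex type `FermionTorus 2 L = Lex (Fin 2 → Fin L)`,
nearest-neighbour graph pulled back from `ℤ²`) satisfies, with `C = 0` and
`c = 5(2 + |U| + 2|μ|)`: the volume bound `a(L) ≥ -cL²` (at most `5L²` local terms of norm
`≤ 2 + |U| + 2|μ|`), tiling sub-additivity `a(kM) ≤ k² a(M)` (the box is the `L × L` rectangle;
stack `k` strips, transpose, stack again: induced row cuts of rectangles, whose cross bonds cost
nothing, `gc_groundEnergy_le_add_of_cut`), and monotonicity `a(L) ≤ a(M)` for `M ≤ L` (cut off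
the complementary strips, whose energy is `≤ 0` by the vacuum bound). Ruelle, *Statistical
Mechanics* (1969) §2.1–2.2. [folklore] -/
theorem stub_boxTiling :
    (∀ {Λ : Type} [LinearOrder Λ] [Fintype Λ] (G : SimpleGraph Λ) [DecidableRel G.Adj] (t U μ : ℝ),
      (hamiltonianWith G t U μ).groundEnergy =
        ⨅ N : Fin (2 * Fintype.card Λ + 1), (groundEnergyAt G t U (N : ℕ) - μ * ((N : ℕ) : ℝ))) →
    ∀ U μ : ℝ, ∃ C c : ℝ, 0 ≤ C ∧
      (∀ L : ℕ, -c * (L : ℝ) ^ 2 ≤ (hamiltonianWith ((zdGraph 2).comap (fun x : FermionTorus 2 L => fun i : Fin 2 => ((ofLex x i : ℕ) : ℤ))) 1 U μ).groundEnergy) ∧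
      (∀ k M : ℕ, (hamiltonianWith ((zdGraph 2).comap (fun x : FermionTorus 2 (k * M) => fun i : Fin 2 => ((ofLex x i : ℕ) : ℤ))) 1 U μ).groundEnergy ≤ (k : ℝ) ^ 2 * (hamiltonianWith ((zdGraph 2).comap (fun x : FermionTorus 2 M => fun i : Fin 2 => ((ofLex x i : ℕ) : ℤ))) 1 U μ).groundEnergy + C * (k : ℝ) ^ 2 * M) ∧
      (∀ L M : ℕ, M ≤ L → (hamiltonianWith ((zdGraph 2).comap (fun x : FermionTorus 2 L => fun i : Fin 2 => ((ofLex x i : ℕ) : ℤ))) 1 U μ).groundEnergy ≤ (hamiltonianWith ((zdGraph 2).comap (fun x : FermionTorus 2 M => fun i : Fin 2 => ((ofLex x i : ℕ) : ℤ))) 1 U μ).groundEnergy + C * L) := by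
  intro hmin U μ
  refine ⟨0, 5 * (2 * |(1 : ℝ)| + |U| + 2 * |μ|), le_rfl, fun L => ?_, fun k M => ?_, fun L M hML => ?_⟩
  · rw [box_groundEnergy_eq_rect]
    have h := neg_le_rect_groundEnergy L L 1 U μ
    convert h using 2
    ring
  · rw [box_groundEnergy_eq_rect, box_groundEnergy_eq_rect, zero_mul, zero_mul, add_zero]
    exact rect_groundEnergy_sq_mul_le hmin k M 1 U μ
  · obtain ⟨D, rfl⟩ := Nat.exists_eq_add_of_le hML
    rw [box_groundEnergy_eq_rect, box_groundEnergy_eq_rect, zero_mul, add_zero]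
    exact rect_groundEnergy_sq_add_le hmin M D 1 U μ

end Summit.HubbardSuperconductivity.HubbardSuperconductivity.Theorems
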